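import Summits.AtomisticToContinuum.Crystallization.Theorems.FrustratedLawDichotomyExemptAbsorptionRecord
import Summits.AtomisticToContinuum.Crystallization.Theorems.FrustratedLawDichotomyStrainedPatchHomSplit
import Summits.AtomisticToContinuum.Crystallization.Theorems.FrustratedLawDichotomyStrainedPatchHomLattice
import Mathlib.Analysis.Calculus.Deriv.MeanValue
import Mathlib.Analysis.InnerProductSpace.Calculus

/-!
# The one-atom MOVE TEST from a SLOPE BOUND along a segment (soundness core of the force/exempt prune)

decomp-a2c hand-1 g26 (crux `AperiodicFrustratedLawGap`, stmt-AtomisticToContinuum-27623; `(H) HomFloor (1/625)`, hcp half).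
The exemption of record `ExRec` of `…StrainedPatchHomSplit` contains `NonEquilibriumCore (−0.7175) 0 7 s (1/10000)`, whose first disjunct is the
one-atom move test `MoveUnstableCore ε Rm s` of `…ExemptAbsorptionRecord`: some trial position `p` with `dist p (y j) ≤ s`, `< 7/10`, lowers the
Lennard-Jones field of the atoms within `Rm` of `y j` by more than the slack `ε + s·(Rm/(Rm − s))⁷·S₇♯(Rm)`.

This file proves the analytic entry point a Boolean force-prune leaf needs (memo `HOME/decomp-a2c-hand-1/g26/C2-MEMO-hand-1-g26.md`, lever (C′)):
★ `moveUnstableCore_of_slope` — if along the straight move `τ ↦ y j + τ • e` (`‖e‖ ≤ 1`, `0 < s < 7/10`, every other atom farther than `s` from `y j`)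
the SLOPE of the local field, `Σ_k (r_k⁻⁸ − r_k⁻¹⁴)·⟪y j + τ e − y k, e⟫` (`r_k = ‖y j + τ e − y k‖`, i.e. `V′(r_k)/r_k · ⟪·, e⟫`), is `≤ −b` for all
`τ ∈ [0, s]`, and `ε + slack(s) < b·s`, then `MoveUnstableCore ε Rm s N y j`.  Ingredients: the chain rule through `V(‖w‖) = W(‖w‖²)`,
`W(u) = u⁻⁶/12 − u⁻³/6` (§1; the two elementary steps `V(‖w‖) = W(‖w‖²)` and `W′` are inlined as `have`s — they are the
`lennardJones_norm_eq` / `hasDerivAt_profile` of `…NashTwoShellGapForceBalance`, whose `hasDerivAt_lennardJones_line` is the `τ = 0` case of ours;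
that module is not imported because the check farm does not serve it, `remote:stale:unbuilt`), linearity over the local finset (§2), the mean
value inequality on `[0, s]` (§3).

NO definitions; 0 sorry; standard axioms; no instances / notation / `#eval`.
`--supports stmt-AtomisticToContinuum-27623`.
-/

noncomputable section

namespace Summit.AtomisticToContinuum.Crystallization.Theorems.FrustratedLawDichotomyStrainedPatchHomExemptMove

open scoped BigOperators RealInnerProductSpace
open Literature.MathematicalPhysics.StatisticalMechanics (lennardJones)
open Summit.AtomisticToContinuum.Crystallization.Theorems.ChargedEnergyGapNegative (E3)
open Summit.AtomisticToContinuum.Crystallization.Theorems.FrustratedLawDichotomyExemptAbsorptionRecord (MoveUnstableCore NonEquilibriumCore)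
open Summit.AtomisticToContinuum.Crystallization.Theorems.FrustratedLawDichotomyExemptAbsorption (ExemptNear)
open Summit.AtomisticToContinuum.Crystallization.Theorems.FrustratedLawDichotomyCollarCensus (Collar)
open Summit.AtomisticToContinuum.Crystallization.Theorems.FrustratedLawDichotomyAveragingCut (ball self_mem_ball)
open Summit.AtomisticToContinuum.Crystallization.Theorems.FrustratedLawDichotomyStrainedPatchHomSplit (ExRec latPt hexFrame hcpShift)
open Summit.AtomisticToContinuum.Crystallization.Theorems.FrustratedLawDichotomyStrainedPatchHomLattice (sum_eq_finsum_mem_of_locHom)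

/-! ## §1. One pair term along a line -/

/-- ★ **Derivative of one pair term along the move line** at a general parameter `τ`: for `c = d + τe ≠ 0`,
`t ↦ V_LJ(‖d + t e‖)` has derivative `(‖c‖⁻⁸ − ‖c‖⁻¹⁴)·⟪c, e⟫ = V′(‖c‖)/‖c‖·⟪c, e⟫` at `τ`. [folklore] -/
theorem hasDerivAt_lennardJones_line (d e : E3) {τ : ℝ} (h : d + τ • e ≠ 0) :
    HasDerivAt (fun t : ℝ => lennardJones ‖d + t • e‖) ((((‖d + τ • e‖⁻¹) ^ 8 - (‖d + τ • e‖⁻¹) ^ 14)) * ⟪d + τ • e, e⟫) τ := by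
  set c : E3 := d + τ • e with hc
  have hc0 : ‖c‖ ≠ 0 := norm_ne_zero_iff.2 h
  have hc2 : ‖c‖ ^ 2 ≠ 0 := pow_ne_zero 2 hc0
  -- `V(‖w‖) = W(‖w‖²)`, `W(u) = u⁻⁶/12 − u⁻³/6`
  have hnorm : ∀ w : E3, lennardJones ‖w‖ = (1 / 12) * ((‖w‖ ^ 2)⁻¹) ^ 6 - (1 / 6) * ((‖w‖ ^ 2)⁻¹) ^ 3 := fun w => by
    simp only [lennardJones, inv_pow, ← pow_mul]
  -- `W′(u) = −u⁻⁷/2 + u⁻⁴/2` at `u = ‖c‖² ≠ 0`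
  have hprof : ∀ {u : ℝ}, u ≠ 0 → HasDerivAt (fun v : ℝ => (1 / 12) * (v⁻¹) ^ 6 - (1 / 6) * (v⁻¹) ^ 3)
      (-(1 / 2) * (u⁻¹) ^ 7 + (1 / 2) * (u⁻¹) ^ 4) u := fun {u} hu => by
    have h1 : HasDerivAt (fun v : ℝ => v⁻¹) (-(u ^ 2)⁻¹) u := hasDerivAt_inv hu
    have h := ((h1.fun_pow 6).const_mul (1 / 12 : ℝ)).fun_sub ((h1.fun_pow 3).const_mul (1 / 6 : ℝ))
    refine h.congr_deriv ?_
    have e7 : (u⁻¹) ^ 7 = (u⁻¹) ^ 5 * (u ^ 2)⁻¹ := by rw [← inv_pow]; ring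
    have e4 : (u⁻¹) ^ 4 = (u⁻¹) ^ 2 * (u ^ 2)⁻¹ := by rw [← inv_pow]; ring
    rw [e7, e4]
    push_cast
    ring
  have hpath : HasDerivAt (fun t : ℝ => d + t • e) e τ := by
    simpa using ((hasDerivAt_id τ).smul_const e).const_add d
  have hq : HasDerivAt (fun t : ℝ => ‖d + t • e‖ ^ 2) (2 * ⟪c, e⟫) τ := hpath.norm_sq
  have hW : HasDerivAt (fun v : ℝ => (1 / 12) * (v⁻¹) ^ 6 - (1 / 6) * (v⁻¹) ^ 3)
      (-(1 / 2) * ((‖c‖ ^ 2)⁻¹) ^ 7 + (1 / 2) * ((‖c‖ ^ 2)⁻¹) ^ 4) ((fun t : ℝ => ‖d + t • e‖ ^ 2) τ) := by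
    show HasDerivAt _ _ (‖d + τ • e‖ ^ 2)
    exact hprof hc2
  have hcomp := hW.comp τ hq
  have hfun : (fun t : ℝ => lennardJones ‖d + t • e‖) =
      (fun v : ℝ => (1 / 12) * (v⁻¹) ^ 6 - (1 / 6) * (v⁻¹) ^ 3) ∘ fun t : ℝ => ‖d + t • e‖ ^ 2 := by
    funext t
    simp only [Function.comp, hnorm]
  rw [hfun]
  refine hcomp.congr_deriv ?_
  rw [inv_pow (‖c‖) 8, inv_pow (‖c‖) 14, inv_pow (‖c‖ ^ 2) 7, inv_pow (‖c‖ ^ 2) 4, ← pow_mul, ← pow_mul]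
  norm_num
  ring

/-! ## §2. The local field along the move line and its slope

The LOCAL FIELD of `MoveUnstableCore ε Rm s` at the moved position `y j + τ • e` is `Σ_{k ≠ j, dist (y k) (y j) ≤ Rm} V_LJ(dist (y j + τ e) (y k))`;
its SLOPE is `Σ_k (‖c_k‖⁻⁸ − ‖c_k‖⁻¹⁴)·⟪c_k, e⟫`, `c_k = y j + τ e − y k` (both written out in full below: this file introduces no definitions). -/

/-- Along a short move no other atom is hit: `‖e‖ ≤ 1`, `|τ| ≤ s < dist (y k) (y j)` ⇒ `y j + τ e − y k ≠ 0`. [folklore] -/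
theorem line_ne_zero {N : ℕ} {y : Fin N → E3} {j k : Fin N} {e : E3} (he : ‖e‖ ≤ 1) {s τ : ℝ} (hτ : |τ| ≤ s)
    (hk : s < dist (y k) (y j)) : y j + τ • e - y k ≠ 0 := by
  intro h0
  have hτe : ‖τ • e‖ ≤ s := by
    rw [norm_smul, Real.norm_eq_abs]
    calc |τ| * ‖e‖ ≤ s * 1 := mul_le_mul hτ he (norm_nonneg _) ((abs_nonneg τ).trans hτ)
      _ = s := mul_one s
  have hd : dist (y k) (y j) = ‖τ • e‖ := by
    have : y k - y j = τ • e := by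
      rw [sub_eq_zero] at h0
      rw [← h0]; abel
    rw [dist_eq_norm, this]
  linarith

/-- ★ The local field is differentiable along the move line with derivative the slope sum, wherever no atom is hit. [folklore] -/
theorem hasDerivAt_fieldLine (Rm : ℝ) {N : ℕ} (y : Fin N → E3) (j : Fin N) (e : E3) {τ : ℝ}
    (hfree : ∀ k ∈ (Finset.univ.erase j).filter (fun k => dist (y k) (y j) ≤ Rm), y j + τ • e - y k ≠ 0) :
    HasDerivAt (fun t : ℝ => ∑ k ∈ (Finset.univ.erase j).filter (fun k => dist (y k) (y j) ≤ Rm), lennardJones (dist (y j + t • e) (y k)))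
      (∑ k ∈ (Finset.univ.erase j).filter (fun k => dist (y k) (y j) ≤ Rm),
        ((‖y j + τ • e - y k‖⁻¹) ^ 8 - (‖y j + τ • e - y k‖⁻¹) ^ 14) * ⟪y j + τ • e - y k, e⟫) τ := by
  refine HasDerivAt.fun_sum fun k hk => ?_
  have h := hasDerivAt_lennardJones_line (y j - y k) e (τ := τ) (by rw [sub_add_eq_add_sub]; exact hfree k hk)
  have hfun : (fun t : ℝ => lennardJones (dist (y j + t • e) (y k))) = fun t : ℝ => lennardJones ‖y j - y k + t • e‖ := by
    funext t; rw [dist_eq_norm, sub_add_eq_add_sub]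
  rw [hfun, ← sub_add_eq_add_sub]
  exact h

/-! ## §3. ★ The move test from a slope bound -/

/-- ★★ **`MoveUnstableCore` FROM A SLOPE BOUND** (soundness core of the force/exempt prune of the hcp certificate).  If `‖e‖ ≤ 1`, `0 < s < 7/10`,
every other atom is farther than `s` from `y j`, the slope of the local Lennard-Jones field along `τ ↦ y j + τ e` is `≤ −b` on `[0, s]`, and the
slack of the move test is beaten, `ε + s·(Rm/(Rm−s))⁷·S₇♯(Rm) < b·s`, then the one-atom move test of record fires at `j`. [folklore: mean value inequality] -/
theorem moveUnstableCore_of_slope {ε Rm s b : ℝ} {N : ℕ} {y : Fin N → E3} {j : Fin N} (e : E3) (he : ‖e‖ ≤ 1)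
    (hs0 : 0 < s) (hs7 : s < 7 / 10) (hsep : ∀ k : Fin N, k ≠ j → s < dist (y k) (y j))
    (hslope : ∀ τ ∈ Set.Icc (0 : ℝ) s, ∑ k ∈ (Finset.univ.erase j).filter (fun k => dist (y k) (y j) ≤ Rm),
        ((‖y j + τ • e - y k‖⁻¹) ^ 8 - (‖y j + τ • e - y k‖⁻¹) ^ 14) * ⟪y j + τ • e - y k, e⟫ ≤ -b)
    (hb : ε + s * (Rm / (Rm - s)) ^ 7 * (6000 / 343 * Rm⁻¹ ^ 4 + 2880 / 49 * Rm⁻¹ ^ 5 + 10 / 7 * Rm⁻¹ ^ 6 + 2 * Rm⁻¹ ^ 7) < b * s) :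
    MoveUnstableCore ε Rm s N y j := by
  set S : Finset (Fin N) := (Finset.univ.erase j).filter (fun k => dist (y k) (y j) ≤ Rm) with hS
  set fieldLine : ℝ → ℝ := fun t => ∑ k ∈ S, lennardJones (dist (y j + t • e) (y k)) with hF
  set slopeLine : ℝ → ℝ := fun τ => ∑ k ∈ S, ((‖y j + τ • e - y k‖⁻¹) ^ 8 - (‖y j + τ • e - y k‖⁻¹) ^ 14) * ⟪y j + τ • e - y k, e⟫
    with hSl
  -- freeness of the segment and differentiability of the field on it
  have hfree : ∀ τ ∈ Set.Icc (0 : ℝ) s, ∀ k ∈ S, y j + τ • e - y k ≠ 0 := by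
    intro τ hτ k hk
    have hkj : k ≠ j := (Finset.mem_erase.1 (Finset.mem_filter.1 hk).1).1
    exact line_ne_zero he (s := s) (by rw [abs_of_nonneg hτ.1]; exact hτ.2) (hsep k hkj)
  have hderiv : ∀ τ ∈ Set.Icc (0 : ℝ) s, HasDerivAt fieldLine (slopeLine τ) τ :=
    fun τ hτ => hasDerivAt_fieldLine Rm y j e (hfree τ hτ)
  -- mean value inequality on [0, s]
  have hcont : ContinuousOn fieldLine (Set.Icc 0 s) :=
    fun τ hτ => (hderiv τ hτ).continuousAt.continuousWithinAt
  have hint : interior (Set.Icc (0 : ℝ) s) = Set.Ioo 0 s := interior_Icc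
  have hdiff : DifferentiableOn ℝ fieldLine (interior (Set.Icc 0 s)) := by
    rw [hint]
    exact fun τ hτ => (hderiv τ (Set.Ioo_subset_Icc_self hτ)).differentiableAt.differentiableWithinAt
  have hle : ∀ τ ∈ interior (Set.Icc (0 : ℝ) s), deriv fieldLine τ ≤ -b := by
    rw [hint]
    intro τ hτ
    rw [(hderiv τ (Set.Ioo_subset_Icc_self hτ)).deriv]
    exact hslope τ (Set.Ioo_subset_Icc_self hτ)
  have hmvt := (convex_Icc (0 : ℝ) s).image_sub_le_mul_sub_of_deriv_le hcont hdiff hle 0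
    (Set.left_mem_Icc.2 hs0.le) s (Set.right_mem_Icc.2 hs0.le) hs0.le
  -- `fieldLine s ≤ fieldLine 0 − b s`
  have h0 : fieldLine 0 = ∑ k ∈ S, lennardJones (dist (y j) (y k)) := by
    simp [hF]
  -- the witness move
  refine ⟨y j + s • e, ?_, ?_, ?_⟩
  · rw [dist_eq_norm, add_sub_cancel_left, norm_smul, Real.norm_eq_abs, abs_of_pos hs0]
    calc s * ‖e‖ ≤ s * 1 := mul_le_mul_of_nonneg_left he hs0.le
      _ = s := mul_one s
  · rw [dist_eq_norm, add_sub_cancel_left, norm_smul, Real.norm_eq_abs, abs_of_pos hs0]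
    calc s * ‖e‖ ≤ s * 1 := mul_le_mul_of_nonneg_left he hs0.le
      _ = s := mul_one s
      _ < 7 / 10 := hs7
  · have hs : fieldLine s = ∑ k ∈ S, lennardJones (dist (y j + s • e) (y k)) := rfl
    show (∑ k ∈ S, lennardJones (dist (y j + s • e) (y k))) + _ < ∑ k ∈ S, lennardJones (dist (y j) (y k))
    rw [← hs, ← h0]
    have : fieldLine s - fieldLine 0 ≤ -b * (s - 0) := hmvt
    linarith

/-! ## §4. ★ From the move test at the centre to the `hver` disjunct `ExemptNear (9/5) ExRec z c` -/

/-- ★ A site where the move test of record fires (`ε = 0`, `R_m = 7`, step `s ∈ [0, 3/2]`) is `ExRec`-exempt — witness: the site itself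
(radius `9/2 ≥ 0`), left disjunct of `NonEquilibriumCore`. [formal bookkeeping] -/
theorem exRec_of_moveUnstableCore {M : ℕ} {z : Fin M → E3} {c : Fin M} {s : ℝ} (hs0 : 0 ≤ s) (hs : s ≤ 3 / 2)
    (h : MoveUnstableCore 0 7 s M z c) : ExRec M z c := by
  unfold ExRec Collar NonEquilibriumCore
  exact ⟨c, self_mem_ball (by norm_num) z c, Or.inl ⟨s, hs0, hs, Or.inl h⟩⟩

/-- ★★ … hence the prune disjunct of the `(H)` certificate's `hver` shape, `ExemptNear (9/5) ExRec z c` — witness: the centre itself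
(radius `9/5 ≥ 0`). [formal bookkeeping] -/
theorem exemptNear_of_moveUnstableCore {M : ℕ} {z : Fin M → E3} {c : Fin M} {s : ℝ} (hs0 : 0 ≤ s) (hs : s ≤ 3 / 2)
    (h : MoveUnstableCore 0 7 s M z c) : ExemptNear (9 / 5) ExRec z c := by
  unfold ExemptNear
  exact ⟨c, self_mem_ball (by norm_num) z c, exRec_of_moveUnstableCore hs0 hs h⟩

/-- ★★★ **FORCE/EXEMPT PRUNE, analytic form**: a slope bound `≤ −b` of the centre's `R_m = 7` Lennard-Jones field along a short move
`τ ↦ z c + τ e` (`‖e‖ ≤ 1`, `0 < s < 7/10`, all other atoms farther than `s`), with `s·(7/(7−s))⁷·S₇♯(7) < b·s`, gives the prune disjunct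
`ExemptNear (9/5) ExRec z c` of `…HomEntryFlipHcp.hcpHalf_of_entryTreeShuf`'s `hver`.  (What a Boolean `forceOut` leaf has to certify by interval
arithmetic over its `(U, ξ)`-box is exactly the slope hypothesis; memo C2-MEMO-hand-1-g26 §4.) [folklore chaining] -/
theorem exemptNear_of_slope {s b : ℝ} {M : ℕ} {z : Fin M → E3} {c : Fin M} (e : E3) (he : ‖e‖ ≤ 1)
    (hs0 : 0 < s) (hs7 : s < 7 / 10) (hsep : ∀ k : Fin M, k ≠ c → s < dist (z k) (z c))
    (hslope : ∀ τ ∈ Set.Icc (0 : ℝ) s, ∑ k ∈ (Finset.univ.erase c).filter (fun k => dist (z k) (z c) ≤ 7),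
        ((‖z c + τ • e - z k‖⁻¹) ^ 8 - (‖z c + τ • e - z k‖⁻¹) ^ 14) * ⟪z c + τ • e - z k, e⟫ ≤ -b)
    (hb : s * (7 / (7 - s)) ^ 7 * (6000 / 343 * (7 : ℝ)⁻¹ ^ 4 + 2880 / 49 * (7 : ℝ)⁻¹ ^ 5 + 10 / 7 * (7 : ℝ)⁻¹ ^ 6 + 2 * (7 : ℝ)⁻¹ ^ 7) < b * s) :
    ExemptNear (9 / 5) ExRec z c :=
  exemptNear_of_moveUnstableCore hs0.le (by linarith)
    (moveUnstableCore_of_slope (ε := 0) (Rm := 7) e he hs0 hs7 hsep hslope (by linarith))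

/-! ## §5. ★ At the centre of a homogeneous hcp ball the local sum is a displacement-set `finsum` -/

/-- ★ **CENTRE TRANSFER**: at the centre `c` of a homogeneous hcp `133/10`-ball (the range hypothesis of the `(H)` certificate's `hver`), every
LOCAL finset sum of `MoveUnstableCore` type — over `k ≠ c` with `dist (z k) (z c) ≤ Rm`, `Rm < 133/10`, of a kernel of the displacement
`z k − z c` — is the `finsum` of `v ↦ 𝟙[v ≠ 0 ∧ ‖v‖ ≤ Rm]·P v` over the displacement set `U·L_hex ∪ (U·L_hex + U(hcpShift + ξ))`.  (With
`P v := (‖τe − v‖⁻⁸ − ‖τe − v‖⁻¹⁴)·⟪τe − v, e⟫` this is the slope hypothesis of `exemptNear_of_slope` in lattice form — what the Boolean leaf bounds.)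
[folklore: `…HomLattice.sum_eq_finsum_mem_of_locHom` at the centre, radius `133/10`] -/
theorem localSum_centre_eq_finsum_hcp {M : ℕ} {z : Fin M → E3} {c : Fin M} (hz : Function.Injective z) {U : E3 →L[ℝ] E3} {ξ : E3}
    (hrange : Set.range z = {x : E3 | dist x (z c) ≤ 133 / 10 ∧ ∃ a : Fin 3 → ℤ,
      x = z c + latPt U hexFrame a ∨ x = z c + latPt U hexFrame a + U (hcpShift + ξ)})
    {Rm : ℝ} (hRm : Rm < 133 / 10) (P : E3 → ℝ) :
    ∑ k ∈ (Finset.univ.erase c).filter (fun k => dist (z k) (z c) ≤ Rm), P (z k - z c) =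
      ∑ᶠ v ∈ {v : E3 | ∃ b : Fin 3 → ℤ, v = latPt U hexFrame b ∨ v = latPt U hexFrame b + U (hcpShift + ξ)},
        (if v ≠ 0 ∧ ‖v‖ ≤ Rm then P v else 0) := by
  classical
  set g : E3 → ℝ := fun v => if v ≠ 0 ∧ ‖v‖ ≤ Rm then P v else 0 with hg
  -- (1) the local finset sum is the full site sum of `g (z k − z c)`
  have h1 : ∑ k ∈ (Finset.univ.erase c).filter (fun k => dist (z k) (z c) ≤ Rm), P (z k - z c) = ∑ k : Fin M, g (z k - z c) := by
    rw [Finset.sum_filter]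
    have hc0 : g (z c - z c) = 0 := by simp [hg]
    rw [← Finset.sum_erase (Finset.univ : Finset (Fin M)) (f := fun k => g (z k - z c)) hc0]
    refine Finset.sum_congr rfl fun k hk => ?_
    have hkc : k ≠ c := (Finset.mem_erase.1 hk).1
    have hne : z k - z c ≠ 0 := fun h => hkc (hz (sub_eq_zero.1 h))
    simp only [hg, hne, ne_eq, not_false_eq_true, true_and, dist_eq_norm]
  -- (2) local homogeneity at the centre with radius `133/10`
  have hT : ∀ x : E3, dist x (z c) < 133 / 10 → (x ∈ Set.range z ↔
      x - z c ∈ {v : E3 | ∃ b : Fin 3 → ℤ, v = latPt U hexFrame b ∨ v = latPt U hexFrame b + U (hcpShift + ξ)}) := by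
    intro x hx
    rw [hrange]
    simp only [Set.mem_setOf_eq]
    constructor
    · rintro ⟨-, a, ha | ha⟩
      · exact ⟨a, Or.inl (by rw [ha]; abel)⟩
      · exact ⟨a, Or.inr (by rw [ha]; abel)⟩
    · rintro ⟨b, hb | hb⟩
      · exact ⟨hx.le, b, Or.inl (by rw [← sub_add_cancel x (z c), hb]; abel)⟩
      · exact ⟨hx.le, b, Or.inr (by rw [← sub_add_cancel x (z c), hb]; abel)⟩
  have hgR : ∀ v : E3, 133 / 10 ≤ ‖v‖ → g v = 0 := by
    intro v hv
    have : ¬(v ≠ 0 ∧ ‖v‖ ≤ Rm) := fun h => by linarith [h.2]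
    simp [hg, this]
  rw [h1]
  exact sum_eq_finsum_mem_of_locHom hz hT g hgR

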